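import Summits.QuantumFields.BalabanUV.Beta.NVertexLamMultColTorus
import Summits.QuantumFields.BalabanUV.Beta.NVertexSectorsPeriodised
import Summits.QuantumFields.BalabanUV.Beta.FP.TorusCompanionCorePeriodic
import Summits.QuantumFields.BalabanUV.Beta.FP.TowerHN1Row
import Summits.QuantumFields.BalabanUV.Beta.FP.TowerQN2RowCopies
import Summits.QuantumFields.BalabanUV.Beta.FP.TowerHLinkRows

/-!
# `BalabanUV.Beta.FP.TowerLamSourceDisplay` — road «FP», binder row D1, ROUTE T (β1): **v6's DISPLAYED SOURCE ROW (J-ΛS) `hΛS` IS A THEOREM AT THE ROAD's DATA, EVERY DEPTH**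
# — the torus fold of an2 PART 29 (`NVertexLamMultColTorus.dper_LN_eq_sum_Shat_mul_dper_compH`, the diagonal periodisation of the N-vertex's Λ sector against the
# chart's torus multiplier column) read ON THE `ff` MATRIX BLOCK (one more `perZ`, `Summable.tsum_finsetSum` over the composite constraint Hessian's bi-localisation),
# composed with the road's (J-Λ) `TorusLamJunctionShape.lamJunction_of_dper_eq` at `TowerHN1Row`'s data

WHY (journal [AN2-G70-INTENT-4∕5] PART 28∕29; road [D1P3-G46-INTENT-4] v6 `hΛS`).  v6 displays (J-ΛS) `hΛS : ∀ a₀, Λ-words(r•e_{a₀}) = cΛS • Σ_β Ŝ_{a₀} β • Ĉ_β` with the road's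
own Λ-words of `hH₁f` on the left and `Ĉ_β := (perF T (dper T (compH … β.2 ↑β.1)))|ff`.  (J-Λ) already equates the Λ-words along the storey directions `hbF k (r•e_a)`
with `Pn.cΛ (n+2) • Σ_b colN̂_a b • (perF T (dper T (S^Λ_b)))|ff`; an2's `perF_dper_LN_eq_sum` + PART 29 turn that sum into `Σ_β Ŝ_a β • Ĉ_β`.
WHAT ([folklore] bookkeeping BY NAME; no `def`, no `def … : Prop`, nothing cited, 0 sorry): §1 `summable_dper_compH_right` (the `compH` bricks' right-translation letter from
`compH_hH`), **`sum_col_smul_perF_dper_lamSector_ff_eq`** — `Σ_b colN̂(μ,y) b • (perF T (dper T (S^Λ_b)))|ff = Σ_β Ŝ(μ,y) β • Ĉ_β` on `T = towerTorus Lc (fine Lc M) (n+1)`.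
WHAT THIS IS NOT: not the value of `Pn.cΛ`; not (K2b) ∕ the storeywise rows; nothing of Bałaban's asserted, valued or discharged; 0 estimates; 0∕4 row-D1 binders (hW, hR,
D1Tel, D1Rep); ROOT M‴ p325680 ∕ P5c ∕ D6 untouched; NOT (C1), NOT (T-ID), NOT D1, NEVER «G-an2-4 closed», NOT BetaPertH, NOT continuum, NOT Clay.

HONEST DEPENDENCY (page 1, mandatory): continuum YM on T⁴ ⇐ BetaPertH ∧ nine spine estimates (0/9 proved); BetaPertH ⇐ (D1) ∧ (D4) ∧ CAP+tail;
G-an2-4 gates asym, D1 and NE2/3/4.  HONEST FRAMING (cell contract, verbatim): «discharging `BetaPertH` makes Bałaban's UV stability UNCONDITIONAL —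
a real constructive-QFT result; it is NOT the continuum limit and NOT the Clay problem.»  ABSOLUTE RULE (cell charter, verbatim): «No internally-minted
statement may enter as a cited fact. Every hypothesis is either kernel-proved in this package or a verbatim quotation of a PUBLISHED theorem with page
reference. The manuscript(s) under audit are NOT citable for their own disputed steps — they are the thing under adjudication; programme-internal
(2001/route/tribunal) claims are never citable.»  Road «FP» OWNER, b2b-balaban-beta-d1-p3 gen 46, 2026-08-28.  No existing file touched.
-/

noncomputable section

open scoped BigOperators

namespace Summit.QuantumFields.BalabanUV.Beta.FP.TowerLamSourceDisplay

open Finset Matrix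
open Literature.MathematicalPhysics.QuantumFieldTheory
open Literature.MathematicalPhysics.QuantumFieldTheory.Balaban1983to89
open Literature.MathematicalPhysics.QuantumFieldTheory.Balaban1983to89.Beta
open B4TorusKernel.MultiPeriod (translate)
open B5Prop11Plancherel (fine)
open B6Lemma24Torus (pbox)
open AffineAveraging (Site box toSite)
open OneStepResolventKernel (Fib KInv)
open ExpKernelCalculus (MKer BiLoc VertexFamily)
open InterLevelTransport (SLam)
open BalabanStepJets (lamCoeffOf)
open Summit.QuantumFields.BalabanUV.Beta.AxialDressingRooted (one_le_of_neZero)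
open Summit.QuantumFields.BalabanUV.Beta.CompositeOneShotJets (compH compH_hH)
open Summit.QuantumFields.BalabanUV.Beta.CompositeOneShotJetData (Roots Pins AN)
open Summit.QuantumFields.BalabanUV.Beta.FP.KernelPeriodisationFib (Idx perF perF_apply perZ perZ_apply)
open Summit.QuantumFields.BalabanUV.Beta.FP.KernelPeriodisationFibLoc (dper)
open Summit.QuantumFields.BalabanUV.Beta.FP.TorusGaugeCovariancePairing (wrapPt)
open Summit.QuantumFields.BalabanUV.Beta.FP.TorusCompositeObjects (towerTorus)
open Summit.QuantumFields.BalabanUV.Beta.FP.TorusCompanionCorePeriodic (summable_ff_right_of_biLoc)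
open Summit.QuantumFields.BalabanUV.Beta.NVertexSectorsPeriodised (perF_dper_LN_eq_sum dvd_towerTorus_fine)
open Summit.QuantumFields.BalabanUV.Beta.NVertexLamMultColTorus (dper_LN_eq_sum_Shat_mul_dper_compH)
open Summit.QuantumFields.BalabanUV.Beta.FP.TowerQN2RowCopies (towerTorus_fine_apply)
open AveragingHessianKernels (Bond)
open AveragingContoursRooted (ctr ctrOff)
open Summit.QuantumFields.BalabanUV.Beta.SymAveragingHessianCounts (symLinKerAt symHessFFAt)
open Summit.QuantumFields.BalabanUV.Beta.BorderedHessian (stepScale)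
open Summit.QuantumFields.BalabanUV.Beta.SymShiftedSpread (bhKStepSh)
open Summit.QuantumFields.BalabanUV.Beta.DshAn1 (Dsh)
open Summit.QuantumFields.BalabanUV.Beta.CompositeVertexKernelRec (compLinKer)
open Summit.QuantumFields.BalabanUV.Beta.FP.TorusGaugeCovariance (tgrad)
open Summit.QuantumFields.BalabanUV.Beta.FP.TorusCompositeCompanionSumG (compSumSym)
open Summit.QuantumFields.BalabanUV.Beta.FP.TorusCompositeCompanionFamilyG (onTowerFamily)
open Summit.QuantumFields.BalabanUV.Beta.FP.TowerHLinkRows (hb_top)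
open Summit.QuantumFields.BalabanUV.Beta.FP.TowerHN1Row (htop_of_lock)
open Summit.QuantumFields.BalabanUV.Beta.FP.TowerLamStencilLocality (exists_locStencil_SLam_cf)
open Summit.QuantumFields.BalabanUV.Beta.FP.TowerLamJunctionAssembly (dper_sum_storeyKernels_eq_dper_lamN)
open Summit.QuantumFields.BalabanUV.Beta.FP.TorusLamJunctionShape (lamJunction_of_dper_eq)

/-! ## §1 The fold on the `ff` matrix block -/

section Fold

variable {Lc : ℕ} [NeZero Lc] (R : Roots Lc) (n : ℕ) (M : Fin (3 + 1) → ℕ) [∀ μ, NeZero (M μ)]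

/-- [folklore] the composite constraint Hessians' right-translation letter on the tower torus: `m ↦ dper T (compH … ν w) x (z + T∘m) (inl a) (inl b)` is summable
(`compH_hH`: a vertex family at every rate ⇒ `BiLoc` at rate `1` ⇒ `TorusCompanionCorePeriodic.summable_ff_right_of_biLoc`). -/
theorem summable_dper_compH_right (ν : Fin (3 + 1)) (w x z : Site (3 + 1)) (a b : Fin (3 + 1)) :
    Summable fun m : Site (3 + 1) => dper (towerTorus Lc (fine Lc M) (n + 1)) (compH R.r Lc (n + 1 + 1) ν w) x
      (translate (towerTorus Lc (fine Lc M) (n + 1)) z m) (Sum.inl a) (Sum.inl b) := by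
  obtain ⟨C, hV⟩ := compH_hH (m := n + 1 + 1) (one_le_of_neZero Lc) R.hr 1 zero_le_one
  have hC : 0 ≤ C := (hV ν w).nonneg (Sum.inl 0)
  exact summable_ff_right_of_biLoc (towerTorus Lc (fine Lc M) (n + 1)) (fun β : Fin (3 + 1) × Site (3 + 1) => compH R.r Lc (n + 1 + 1) β.1 β.2)
    (p := fun β => (((Lc ^ (n + 1 + 1) : ℕ) : ℤ)) • β.2) (q := fun β => (((Lc ^ (n + 1 + 1) : ℕ) : ℤ)) • β.2) (C := fun _ => C) (δ := 1)
    (fun β => hV β.1 β.2) (fun _ => hC) one_pos (ν, w) x z a b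

/-- [folklore] **`sum_col_smul_perF_dper_lamSector_ff_eq` — THE TORUS FOLD OF (J-ΛS) ON THE `ff` BLOCK**: on `T = towerTorus Lc (fine Lc M) (n+1)`, for every source `(μ, y)`,
`Σ_{b : pbox T × Fin 4} colN̂(μ,y) b • (perF T (dper T (S^Λ_b)))|ff = Σ_{β : pbox M × Fin 4} Ŝ(μ,y) β • (perF T (dper T (compH R.r Lc (n+2) β.2 ↑β.1)))|ff`
(`S^Λ_b := SLam L (lamCoeffOf (KInv L) L) (compH R.r Lc (n+2)) b.2 ↑b.1`, `L = Lc^(n+2)`; `colN̂`, `Ŝ` the chart's torus field ∕ multiplier columns of the source):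
an2 `perF_dper_LN_eq_sum` (left = `perF T (dper T (ℒN μ y))|ff`), entrywise `perF = perZ ∘ dper`, PART 29 under the `perZ` sum, the sum exchanged by §1's letter. -/
theorem sum_col_smul_perF_dper_lamSector_ff_eq (μ : Fin (3 + 1)) (y : Site (3 + 1)) :
    ∑ b : ↥(pbox (towerTorus Lc (fine Lc M) (n + 1))) × Fin (3 + 1),
        perF (towerTorus Lc (fine Lc M) (n + 1)) (AN R (n + 1)) (b.1, Sum.inl b.2)
            (wrapPt (towerTorus Lc (fine Lc M) (n + 1)) (((Lc ^ (n + 1 + 1) : ℕ) : ℤ) • y), Sum.inr μ) •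
          (perF (towerTorus Lc (fine Lc M) (n + 1)) (dper (towerTorus Lc (fine Lc M) (n + 1))
            (SLam (Lc ^ (n + 1 + 1)) (lamCoeffOf (KInv (N := Lc ^ (n + 1 + 1)) (d := 3)) (Lc ^ (n + 1 + 1))) (compH R.r Lc (n + 1 + 1)) b.2
              (b.1 : Site (3 + 1))))).submatrix
            (fun b : ↥(pbox (towerTorus Lc (fine Lc M) (n + 1))) × Fin (3 + 1) => ((b.1, Sum.inl b.2) : Idx (towerTorus Lc (fine Lc M) (n + 1)) (Fib 3)))
            (fun b : ↥(pbox (towerTorus Lc (fine Lc M) (n + 1))) × Fin (3 + 1) => ((b.1, Sum.inl b.2) : Idx (towerTorus Lc (fine Lc M) (n + 1)) (Fib 3)))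
      = ∑ β : ↥(pbox M) × Fin (3 + 1),
        perF (towerTorus Lc (fine Lc M) (n + 1)) (AN R (n + 1))
            (wrapPt (towerTorus Lc (fine Lc M) (n + 1)) (((Lc ^ (n + 1 + 1) : ℕ) : ℤ) • (β.1 : Site (3 + 1))), Sum.inr β.2)
            (wrapPt (towerTorus Lc (fine Lc M) (n + 1)) (((Lc ^ (n + 1 + 1) : ℕ) : ℤ) • y), Sum.inr μ) •
          (perF (towerTorus Lc (fine Lc M) (n + 1)) (dper (towerTorus Lc (fine Lc M) (n + 1))
            (compH R.r Lc (n + 1 + 1) β.2 (β.1 : Site (3 + 1))))).submatrix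
            (fun b : ↥(pbox (towerTorus Lc (fine Lc M) (n + 1))) × Fin (3 + 1) => ((b.1, Sum.inl b.2) : Idx (towerTorus Lc (fine Lc M) (n + 1)) (Fib 3)))
            (fun b : ↥(pbox (towerTorus Lc (fine Lc M) (n + 1))) × Fin (3 + 1) => ((b.1, Sum.inl b.2) : Idx (towerTorus Lc (fine Lc M) (n + 1)) (Fib 3))) := by
  ext p q
  simp only [Matrix.sum_apply, Matrix.smul_apply, Matrix.submatrix_apply, smul_eq_mul]
  have e := congrArg (fun X : Matrix (Idx (towerTorus Lc (fine Lc M) (n + 1)) (Fib 3)) (Idx (towerTorus Lc (fine Lc M) (n + 1)) (Fib 3)) ℝ =>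
      X (p.1, Sum.inl p.2) (q.1, Sum.inl q.2)) (perF_dper_LN_eq_sum R (n + 1) (towerTorus Lc (fine Lc M) (n + 1)) (dvd_towerTorus_fine M n) μ y)
  simp only [Matrix.sum_apply, Matrix.smul_apply, smul_eq_mul] at e
  rw [← e, perF_apply, perZ_apply]
  have hT : ∀ i, towerTorus Lc (fine Lc M) (n + 1) i = Lc ^ (n + 1 + 1) * M i := towerTorus_fine_apply M n
  simp_rw [dper_LN_eq_sum_Shat_mul_dper_compH R (n + 1) (towerTorus Lc (fine Lc M) (n + 1)) M hT μ y]
  rw [Summable.tsum_finsetSum (fun ν _ => summable_sum fun (r : ↥(pbox M)) _ =>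
    (summable_dper_compH_right R n M ν (r : Site (3 + 1)) (p.1 : Site (3 + 1)) (q.1 : Site (3 + 1)) p.2 q.2).mul_left _)]
  simp_rw [Summable.tsum_finsetSum (fun (r : ↥(pbox M)) _ =>
    (summable_dper_compH_right R n M _ (r : Site (3 + 1)) (p.1 : Site (3 + 1)) (q.1 : Site (3 + 1)) p.2 q.2).mul_left _), tsum_mul_left]
  rw [Fintype.sum_prod_type, Finset.sum_comm]
  refine Finset.sum_congr rfl fun r _ => Finset.sum_congr rfl fun ν _ => ?_
  congr 1

end Fold

/-! ## §2 (J-ΛS) at the road's data: v6's `hΛS` is a theorem -/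

section Source

variable {Lc : ℕ} [NeZero Lc] (n : ℕ) (M : Fin (3 + 1) → ℕ) [∀ i, NeZero (M i)]

variable (P : Pins) (N₁ : ℕ) [NeZero N₁] (lev : ℕ → ℕ) (hlev : ∀ i ≤ n + 1, lev i = n + 1 - i) (rs : ℕ → (Fin (3 + 1) → ℕ))
  -- the road's storey data (as in `TowerWeightWords.weight_word`, at `R := Roots.ctr Lc`)
  {κ : Type*} [Fintype κ] [DecidableEq κ] (yN : κ → Site (3 + 1)) (μN : κ → Fin (3 + 1))
  (hv : (κ → ℝ) → (↥(pbox (towerTorus Lc (fine Lc M) (n + 1))) × Fin (3 + 1) → ℝ))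
  (cfF : ℕ → Fin (3 + 1) → Site (3 + 1) → Fin (3 + 1) → Site (3 + 1) → ℝ)
  (hcfF : ∀ (k : ℕ) (μ : Fin (3 + 1)) (s : Site (3 + 1)) (κ' : Fin (3 + 1)) (x : Site (3 + 1)), cfF k μ s κ' x
    = if k = n + 1 then
        ∑ ν : Fin (3 + 1), ∑' w : Site (3 + 1), lamCoeffOf (KInv (N := Lc ^ (n + 1 + 1)) (d := 3)) (Lc ^ (n + 1 + 1)) ν w κ' x
          * compLinKer (fun _ => symLinKerAt (toSite (Roots.ctr Lc).r) Lc) Lc (n + 1) (μ, s) (ν, w)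
      else (if x = (Lc : ℤ) • s ∧ κ' = μ then (1 : ℝ) else 0))
  (hbF : (k : ℕ) → (κ → ℝ) → (↥(pbox (towerTorus Lc (fine Lc M) k)) × Fin (3 + 1) → ℝ))
  (hhbF : ∀ (k : ℕ) (v : κ → ℝ) (ā : ↥(pbox (towerTorus Lc (fine Lc M) k)) × Fin (3 + 1)), hbF k v ā
    = if k = n + 1 then hv v (wrapPt (towerTorus Lc (fine Lc M) (n + 1)) (ā.1 : Site (3 + 1)), ā.2)
      else ∑ y₀ : ↥(pbox (towerTorus Lc M k)), (if (ā.1 : Site (3 + 1)) = (Lc : ℤ) • (y₀ : Site (3 + 1)) then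
        ∑ a : κ, v a * ∑' nn : Site (3 + 1), ∑ ν : Fin (3 + 1), ∑' w : Site (3 + 1),
          (∑ κ' : Fin (3 + 1), ∑' u' : Site (3 + 1),
              AN (Roots.ctr Lc) (n + 1) u' (((Lc ^ (n + 1 + 1) : ℕ) : ℤ) • yN a) (Sum.inl κ') (Sum.inr (μN a))
                * lamCoeffOf (KInv (N := Lc ^ (n + 1 + 1)) (d := 3)) (Lc ^ (n + 1 + 1)) ν w κ' u')
            * compLinKer (fun _ => symLinKerAt (toSite (Roots.ctr Lc).r) Lc) Lc k (ā.2, translate (towerTorus Lc M k) (y₀ : Site (3 + 1)) nn) (ν, w)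
        else 0))
  (c : ℝ) (κF wF : ℕ → ℝ)
  (hκF : ∀ k, κF k = ∏ i ∈ Finset.Ico k (n + 1), (stepScale 3 Lc (n + 1 - (i + 1)) * ((box (3 + 1) Lc).card : ℝ)))
  (hwF : ∀ k, wF k = (-(c * ((Lc : ℝ) ^ (3 + 1)) ^ (n + 1 + 1))
      / ∏ i ∈ Finset.Ico k (n + 1), (stepScale 3 Lc (n + 1 - (i + 1)) * (Lc : ℝ) ^ (3 + 1))) / κF k)
  (T' : Fin (3 + 1) → ℕ) (hT' : ∀ i, towerTorus Lc (fine Lc M) (n + 1) i = Lc * T' i)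
  (hhvl : ∀ (r : ℝ) (x y : κ → ℝ), hv (r • x + y) = r • hv x + hv y)
  -- the wrapper's tree-gauge read-out `lv` (linear, `hlv`); the gauge function of the source `e_a` is `lv e_a`
  (lv : (κ → ℝ) → ↥(pbox (towerTorus Lc (fine Lc M) (n + 1))) → ℝ)
  (hlv : ∀ (r : ℝ) (x y : κ → ℝ), lv (r • x + y) = r • lv x + lv y)
  (hJW : ∀ (a : κ) (b : ↥(pbox (towerTorus Lc (fine Lc M) (n + 1))) × Fin (3 + 1)), hv (Pi.single a 1) b
      = perF (towerTorus Lc (fine Lc M) (n + 1)) (AN (Roots.ctr Lc) (n + 1)) (b.1, Sum.inl b.2)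
          (wrapPt (towerTorus Lc (fine Lc M) (n + 1)) (((Lc ^ (n + 1 + 1) : ℕ) : ℤ) • yN a), Sum.inr (μN a))
        - ∑ s : ↥(pbox (towerTorus Lc (fine Lc M) (n + 1))), tgrad (towerTorus Lc (fine Lc M) (n + 1)) (b.1, Sum.inl b.2) s * lv (Pi.single a 1) s)
  (hfold : ∀ (μ : Fin (3 + 1)) (y : Site (3 + 1)) (κ₁ : Fin (3 + 1)) (s₁ : Site (3 + 1)),
      ∑ ā : ↥(pbox (towerTorus Lc (fine Lc M) (n + 1))) × Fin (3 + 1),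
          perF (towerTorus Lc (fine Lc M) (n + 1)) (AN (Roots.ctr Lc) (n + 1)) (ā.1, Sum.inl ā.2)
              (wrapPt (towerTorus Lc (fine Lc M) (n + 1)) (((Lc ^ (n + 1 + 1) : ℕ) : ℤ) • y), Sum.inr μ)
            * (∑' m : Site (3 + 1), ∑ ν : Fin (3 + 1), ∑' w : Site (3 + 1),
                lamCoeffOf (KInv (N := Lc ^ (n + 1 + 1)) (d := 3)) (Lc ^ (n + 1 + 1)) ν w ā.2 (ā.1 : Site (3 + 1))
                  * compLinKer (fun _ => symLinKerAt (toSite (Roots.ctr Lc).r) Lc) Lc (n + 1) (κ₁, translate T' s₁ m) (ν, w))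
        = ∑' m : Site (3 + 1), ∑ ν : Fin (3 + 1), ∑' w : Site (3 + 1),
            (∑ κ' : Fin (3 + 1), ∑' u' : Site (3 + 1),
                AN (Roots.ctr Lc) (n + 1) u' (((Lc ^ (n + 1 + 1) : ℕ) : ℤ) • y) (Sum.inl κ') (Sum.inr μ)
                  * lamCoeffOf (KInv (N := Lc ^ (n + 1 + 1)) (d := 3)) (Lc ^ (n + 1 + 1)) ν w κ' u')
              * compLinKer (fun _ => symLinKerAt (toSite (Roots.ctr Lc).r) Lc) Lc (n + 1) (κ₁, translate T' s₁ m) (ν, w))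
  -- the pinned direction `dv = r•e_a`: the pin `(−2c)·r = cE (n+2)` and the LOCK ROW (R-FP-81)
  (r : ℝ) (hr : (-2 * c) * r = P.cE (n + 1 + 1)) (hcΛ : 2 * P.cΛ (n + 1 + 1) = ((Lc : ℝ) ^ (3 + 1)) ^ (n + 1 + 1) * P.cE (n + 1 + 1)) (a : κ)
  -- the wrapper's form pin at the finest storey
  {H₀ : Matrix (↥(pbox (towerTorus Lc (fine Lc M) (n + 1))) × Fin (3 + 1)) (↥(pbox (towerTorus Lc (fine Lc M) (n + 1))) × Fin (3 + 1)) ℝ}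
  (hH₀ : H₀ = (perF (towerTorus Lc (fine Lc M) (n + 1)) (bhKStepSh 3 Lc (Dsh Lc) 0)).submatrix
      (fun b : ↥(pbox (towerTorus Lc (fine Lc M) (n + 1))) × Fin (3 + 1) => ((b.1, Sum.inl b.2) : Idx (towerTorus Lc (fine Lc M) (n + 1)) (Fib 3)))
      (fun b : ↥(pbox (towerTorus Lc (fine Lc M) (n + 1))) × Fin (3 + 1) => ((b.1, Sum.inl b.2) : Idx (towerTorus Lc (fine Lc M) (n + 1)) (Fib 3))))
  (hLc : 2 ≤ Lc)

include hlev hcfF hhbF hκF hwF hT' hhvl hJW hfold hr hcΛ hLc in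
/-- [folklore] **`hΛS_of_road_data` — v6's DISPLAYED ROW (J-ΛS) AT THE SOURCE `a`, AS A THEOREM AT THE ROAD's DATA** (`TowerHN1Row`'s letters VERBATIM): the road's Λ-words of
`hH₁f` along `r•e_a` (top storey read at `hv` by `hb_top`) `= Pn.cΛ (n+2) • Σ_β Ŝ_a β • Ĉ_β`, `Ĉ_β = (perF T (dper T (compH (Roots.ctr Lc).r Lc (n+2) β.2 ↑β.1)))|ff` — (J-Λ)
`TorusLamJunctionShape.lamJunction_of_dper_eq` fed exactly as in `TowerHN1Row.hHN1_of_road_data`, then §1.  So v7 pins `cΛS n := Pn.cΛ (n+2)` and drops `hΛS`. -/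
theorem hΛS_of_road_data :
    wF (n + 1) • ∑ ā : ↥(pbox (towerTorus Lc (fine Lc M) (n + 1))) × Fin (3 + 1), hv (r • (Pi.single a (1 : ℝ) : κ → ℝ)) ā •
          (perF (towerTorus Lc (fine Lc M) (n + 1)) (dper (towerTorus Lc (fine Lc M) (n + 1))
            (SLam N₁ (cfF (n + 1)) (fun μ y => symHessFFAt (toSite (ctrOff (3 + 1) Lc)) Lc μ y) ā.2 (ā.1 : Site (3 + 1))))).submatrix
            (fun b : ↥(pbox (towerTorus Lc (fine Lc M) (n + 1))) × Fin (3 + 1) => ((b.1, Sum.inl b.2) : Idx (towerTorus Lc (fine Lc M) (n + 1)) (Fib 3)))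
            (fun b : ↥(pbox (towerTorus Lc (fine Lc M) (n + 1))) × Fin (3 + 1) => ((b.1, Sum.inl b.2) : Idx (towerTorus Lc (fine Lc M) (n + 1)) (Fib 3)))
        + compSumSym Lc (onTowerFamily Lc (fine Lc M) (fun k => wF k • ∑ ā : ↥(pbox (towerTorus Lc (fine Lc M) k)) × Fin (3 + 1),
            hbF k (r • (Pi.single a (1 : ℝ) : κ → ℝ)) ā •
          (perF (towerTorus Lc (fine Lc M) k) (dper (towerTorus Lc (fine Lc M) k)
            (SLam N₁ (cfF k) (fun μ y => symHessFFAt (toSite (ctrOff (3 + 1) Lc)) Lc μ y) ā.2 (ā.1 : Site (3 + 1))))).submatrix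
            (fun b : ↥(pbox (towerTorus Lc (fine Lc M) k)) × Fin (3 + 1) => ((b.1, Sum.inl b.2) : Idx (towerTorus Lc (fine Lc M) k) (Fib 3)))
            (fun b : ↥(pbox (towerTorus Lc (fine Lc M) k)) × Fin (3 + 1) => ((b.1, Sum.inl b.2) : Idx (towerTorus Lc (fine Lc M) k) (Fib 3))))) (fine Lc M) lev rs (n + 1)
      = P.cΛ (n + 1 + 1) • ∑ β : ↥(pbox M) × Fin (3 + 1),
        perF (towerTorus Lc (fine Lc M) (n + 1)) (AN (Roots.ctr Lc) (n + 1))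
            (wrapPt (towerTorus Lc (fine Lc M) (n + 1)) (((Lc ^ (n + 1 + 1) : ℕ) : ℤ) • (β.1 : Site (3 + 1))), Sum.inr β.2)
            (wrapPt (towerTorus Lc (fine Lc M) (n + 1)) (((Lc ^ (n + 1 + 1) : ℕ) : ℤ) • yN a), Sum.inr (μN a)) •
          (perF (towerTorus Lc (fine Lc M) (n + 1)) (dper (towerTorus Lc (fine Lc M) (n + 1)) (compH (Roots.ctr Lc).r Lc (n + 1 + 1) β.2 (β.1 : Site (3 + 1))))).submatrix (fun b : ↥(pbox (towerTorus Lc (fine Lc M) (n + 1))) × Fin (3 + 1) => ((b.1, Sum.inl b.2) : Idx (towerTorus Lc (fine Lc M) (n + 1)) (Fib 3))) (fun b : ↥(pbox (towerTorus Lc (fine Lc M) (n + 1))) × Fin (3 + 1) => ((b.1, Sum.inl b.2) : Idx (towerTorus Lc (fine Lc M) (n + 1)) (Fib 3))) := by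
  obtain ⟨δ, hδ, Cs, hCs, hLS⟩ := exists_locStencil_SLam_cf (Roots.ctr Lc) n N₁ cfF hcfF
  have J := lamJunction_of_dper_eq (Roots.ctr Lc) P N₁ n M lev rs
      (fun i μ y g => stepScale 3 Lc (lev (n + 1 - i)) * ((Lc : ℝ) ^ (3 + 1) * symLinKerAt (ctr (3 + 1) Lc) Lc μ y g))
      (fun μ y => symHessFFAt (toSite (ctrOff (3 + 1) Lc)) Lc μ y) cfF wF (fun k => hbF k (r • (Pi.single a (1 : ℝ) : κ → ℝ))) hLS hCs hδ
      (fun _ _ _ _ _ => rfl)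
      (𝒦 := fun j β β' b b' => ∑ a₁ : Fin (3 + 1), ∑ a₁' : Fin (3 + 1), ∑' γ : Site (3 + 1), ∑' γ' : Site (3 + 1),
        compLinKer (fun i μ y g => stepScale 3 Lc (lev (n + 1 - i)) * ((Lc : ℝ) ^ (3 + 1) * symLinKerAt (ctr (3 + 1) Lc) Lc μ y g)) Lc (n + 1 - j) (b, β) (a₁, γ)
          * (wF j * ∑ ā : ↥(pbox (towerTorus Lc (fine Lc M) j)) × Fin (3 + 1),
              hbF j (r • (Pi.single a (1 : ℝ) : κ → ℝ)) ā
                * SLam N₁ (cfF j) (fun μ' y' => symHessFFAt (toSite (ctrOff (3 + 1) Lc)) Lc μ' y') ā.2 (ā.1 : Site (3 + 1)) γ γ' (Sum.inl a₁) (Sum.inl a₁'))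
          * compLinKer (fun i μ y g => stepScale 3 Lc (lev (n + 1 - i)) * ((Lc : ℝ) ^ (3 + 1) * symLinKerAt (ctr (3 + 1) Lc) Lc μ y g)) Lc (n + 1 - j)
              (b', β') (a₁', γ'))
      (fun _ _ _ _ _ _ => rfl) (μN a) (yN a) hLc
      (dper_sum_storeyKernels_eq_dper_lamN n M P N₁ lev hlev
        (fun i μ y g => stepScale 3 Lc (lev (n + 1 - i)) * ((Lc : ℝ) ^ (3 + 1) * symLinKerAt (ctr (3 + 1) Lc) Lc μ y g)) (fun _ _ _ _ _ => rfl)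
        yN μN hv cfF hcfF hbF hhbF c κF wF hκF hwF T' hT' hhvl (fun a' => lv (Pi.single a' 1)) hJW hfold r
        (htop_of_lock n c κF wF hκF hwF r (P.cE (n + 1 + 1)) (P.cΛ (n + 1 + 1)) hr hcΛ) a (fun _ _ _ _ _ _ => rfl))
  rw [hb_top (Roots.ctr Lc) n M yN μN hv hbF hhbF (r • (Pi.single a (1 : ℝ) : κ → ℝ))] at J
  rw [J, sum_col_smul_perF_dper_lamSector_ff_eq]

end Source

end Summit.QuantumFields.BalabanUV.Beta.FP.TowerLamSourceDisplay

end
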